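import Mathlib.GroupTheory.Perm.Basic
import Mathlib.GroupTheory.Perm.ViaEmbedding
import Mathlib.GroupTheory.Index
import Mathlib.Data.Fintype.Perm
import Mathlib.Algebra.Order.BigOperators.Group.Finset
import Mathlib.Topology.Algebra.OpenSubgroup
import Mathlib.SetTheory.Cardinal.Finite
import HarnessLib

/-!
# Characteristic open subgroups of a topologically finitely generated group, with a uniform index bound

Mochizuki, *Inter-universal Teichmüller theory I*, Remark 2.5.3 (i) (T3)/(T4), kurims manuscript p. 53
[cite: Mochizuki2012, IUTchI Rem. 2.5.3(i)(T4) p.53]: for a *strictly coherent* semi-graph of anabelioids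
("each of the profinite groups associated to components `c` … is topologically generated by `N`
generators, for some positive integer `N` that is independent of `c`") "one verifies immediately that
every strictly coherent, countable semi-graph of anabelioids is Galois-countable" — the verification
rests on the following uniformity: a topological group topologically generated by `≤ N` elements has at
most `(i!)^N` homomorphisms to `𝔖_i` with open kernel, hence an OPEN NORMAL subgroup `U_i` of index
`≤ (i!)^((i!)^N)` — a bound depending only on `(N, i)` — contained in the kernel of every such
homomorphism (so in every open subgroup of index `≤ i`).  Quantitative companion to
`TopFGOpenSubgroups.lean` (abc-iut-L5-t6: finitely many open subgroups of each index); Mathlib-only.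
Proof-only (no definitions; `U_i` is produced existentially).
-/

namespace Literature.AnabelianGeometry.AbsoluteAnabelian

namespace IsTopologicallyFinitelyGenerated

open scoped Nat

universe u

variable {G : Type u} [Group G] [TopologicalSpace G] [IsTopologicalGroup G]

/-- Quantitative finiteness: if `G` is topologically generated by the finset `s`, the homomorphisms
`G → M` (`M` finite) with open kernel are finitely many, at most `|M| ^ |s|` (they are determined by
their values on `s`). [cite: Mochizuki2012, IUTchI Rem. 2.5.3(i)(T4) p.53] -/
theorem card_setOf_monoidHom_isOpen_ker_le {M : Type*} [Group M] [Finite M] (s : Finset G)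
    (hs : (Subgroup.closure (s : Set G)).topologicalClosure = ⊤) :
    Finite {ρ : G →* M | IsOpen (ρ.ker : Set G)} ∧
      Nat.card {ρ : G →* M | IsOpen (ρ.ker : Set G)} ≤ Nat.card M ^ s.card := by
  classical
  -- two homomorphisms with open kernels agreeing on `s` agree on the closure of the (closed, since
  -- open) agreement subgroup, i.e. everywhere
  have heq : ∀ {ρ ρ' : G →* M}, IsOpen (ρ.ker : Set G) → IsOpen (ρ'.ker : Set G) →
      Set.EqOn ρ ρ' (s : Set G) → ρ = ρ' := by
    intro ρ ρ' hρ hρ' h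
    have hle : ρ.ker ⊓ ρ'.ker ≤ ρ.eqLocus ρ' := by
      intro g hg
      change ρ g = ρ' g
      rw [(MonoidHom.mem_ker).mp hg.1, (MonoidHom.mem_ker).mp hg.2]
    have hopen : IsOpen (ρ.eqLocus ρ' : Set G) := Subgroup.isOpen_mono hle (hρ.inter hρ')
    have hclosed : IsClosed (ρ.eqLocus ρ' : Set G) := Subgroup.isClosed_of_isOpen _ hopen
    have hcl : Subgroup.closure (s : Set G) ≤ ρ.eqLocus ρ' := (Subgroup.closure_le _).mpr h
    have htop : ρ.eqLocus ρ' = ⊤ := by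
      rw [eq_top_iff, ← hs]
      exact Subgroup.topologicalClosure_minimal _ hcl hclosed
    ext g
    have hg : g ∈ ρ.eqLocus ρ' := by rw [htop]; exact Subgroup.mem_top g
    exact hg
  let r : {ρ : G →* M | IsOpen (ρ.ker : Set G)} → (s → M) := fun ρ x => ρ.1 x
  have hinj : Function.Injective r := by
    intro ρ ρ' hf
    apply Subtype.ext
    exact heq ρ.2 ρ'.2 fun x hx => congrFun hf ⟨x, hx⟩
  refine ⟨Finite.of_injective r hinj, ?_⟩
  calc Nat.card {ρ : G →* M | IsOpen (ρ.ker : Set G)}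
      ≤ Nat.card (s → M) := Nat.card_le_card_of_injective r hinj
    _ = Nat.card M ^ s.card := by
        rw [Nat.card_fun, Nat.card_eq_fintype_card (α := s), Fintype.card_coe]

/-- **Characteristic open subgroups with a uniform index bound.**  If `G` is topologically generated by
a finset `s`, then for every `i` there is an open normal subgroup `U` of finite index
`≤ (i!)^((i!)^|s|)` contained in the kernel of every homomorphism `G → 𝔖_i` with open kernel (hence in
every open subgroup of index `≤ i`, such a subgroup being a point stabiliser of such a homomorphism).
[cite: Mochizuki2012, IUTchI Rem. 2.5.3(i)(T4) p.53] -/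
theorem exists_open_normal_le_ker (s : Finset G)
    (hs : (Subgroup.closure (s : Set G)).topologicalClosure = ⊤) (i : ℕ) :
    ∃ U : Subgroup G, U.Normal ∧ IsOpen (U : Set G) ∧ U.index ≠ 0 ∧
      U.index ≤ (i !) ^ ((i !) ^ s.card) ∧
      ∀ ρ : G →* Equiv.Perm (Fin i), IsOpen (ρ.ker : Set G) → U ≤ ρ.ker := by
  classical
  let T : Set (G →* Equiv.Perm (Fin i)) := {ρ | IsOpen (ρ.ker : Set G)}
  obtain ⟨hTfin, hTcard⟩ := card_setOf_monoidHom_isOpen_ker_le (M := Equiv.Perm (Fin i)) s hs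
  have hperm : Nat.card (Equiv.Perm (Fin i)) = i ! := by
    rw [Nat.card_eq_fintype_card, Fintype.card_perm, Fintype.card_fin]
  rw [hperm] at hTcard
  haveI : Finite T := hTfin
  letI : Fintype T := Fintype.ofFinite T
  let U : Subgroup G := ⨅ ρ : T, (ρ.1).ker
  have hker_index : ∀ ρ : T, (ρ.1).ker.index ≤ i ! := by
    intro ρ
    rw [Subgroup.index_ker]
    calc Nat.card (ρ.1).range ≤ Nat.card (Equiv.Perm (Fin i)) :=
          Nat.card_le_card_of_injective _ Subtype.val_injective
      _ = i ! := by rw [Nat.card_eq_fintype_card, Fintype.card_perm, Fintype.card_fin]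
  have hker_ne : ∀ ρ : T, (ρ.1).ker.index ≠ 0 := by
    intro ρ
    rw [Subgroup.index_ker]
    exact Nat.card_pos.ne'
  refine ⟨U, Subgroup.normal_iInf_normal fun ρ => inferInstance, ?_, Subgroup.index_iInf_ne_zero hker_ne,
    ?_, fun ρ hρ => iInf_le (fun ρ : T => (ρ.1).ker) ⟨ρ, hρ⟩⟩
  · -- open: a finite intersection of open kernels
    have : (U : Set G) = ⋂ ρ : T, ((ρ.1).ker : Set G) := by
      simp [U, Subgroup.coe_iInf]
    rw [this]
    exact isOpen_iInter_of_finite fun ρ => ρ.2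
  · -- index bound
    calc U.index ≤ ∏ ρ : T, (ρ.1).ker.index := Subgroup.index_iInf_le _
      _ ≤ ∏ _ρ : T, i ! := Finset.prod_le_prod' fun ρ _ => hker_index ρ
      _ = (i !) ^ Fintype.card T := by rw [Finset.prod_const, Finset.card_univ]
      _ ≤ (i !) ^ ((i !) ^ s.card) := by
          apply Nat.pow_le_pow_right (Nat.factorial_pos i)
          rwa [← Nat.card_eq_fintype_card]

omit [IsTopologicalGroup G] in
/-- The kernel of the action on a finite set of size `≤ i` contains the characteristic subgroup: if
`ρ : G → 𝔖(X)` has open kernel and `|X| ≤ i`, every subgroup contained in all open-kernel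
homomorphisms to `𝔖_i` lies in `ker ρ` (embed `𝔖(X) ↪ 𝔖_i`).
[cite: Mochizuki2012, IUTchI Rem. 2.5.3(i)(T4) p.53] -/
theorem le_ker_of_card_le {X : Type*} [Finite X] {i : ℕ} (hX : Nat.card X ≤ i) (U : Subgroup G)
    (hU : ∀ ρ : G →* Equiv.Perm (Fin i), IsOpen (ρ.ker : Set G) → U ≤ ρ.ker)
    (ρ : G →* Equiv.Perm X) (hρ : IsOpen (ρ.ker : Set G)) : U ≤ ρ.ker := by
  classical
  letI : Fintype X := Fintype.ofFinite X
  -- an embedding `X ↪ Fin i`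
  have hXi : Fintype.card X ≤ Fintype.card (Fin i) := by
    rwa [Fintype.card_fin, ← Nat.card_eq_fintype_card]
  obtain ⟨ι⟩ := Function.Embedding.nonempty_of_card_le hXi
  let j : Equiv.Perm X →* Equiv.Perm (Fin i) := Equiv.Perm.viaEmbeddingHom ι
  have hj : Function.Injective j := Equiv.Perm.viaEmbeddingHom_injective ι
  have hker : (j.comp ρ).ker = ρ.ker := by
    ext g
    simp only [MonoidHom.mem_ker, MonoidHom.coe_comp, Function.comp_apply]
    constructor
    · intro h
      exact hj (by rw [h, map_one])
    · intro h
      rw [h, map_one]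
  have := hU (j.comp ρ) (by rw [hker]; exact hρ)
  rwa [hker] at this

end IsTopologicallyFinitelyGenerated

end Literature.AnabelianGeometry.AbsoluteAnabelian
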